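import Mathlib
import Literature.NumberTheory.Irrationality.Fischler2002.KLSubstitutionProofs
import HarnessLib

/-!
# Fischler 2002 §2, Théorème 2.1 (`𝒦(p) = 𝓛(P)`): the finite-product algebra of the change of variables

Topic `Literature/NumberTheory/Irrationality/Fischler2002`; proofs-only companion of `BeukersSorokinChangeOfVariables.lean`
(second file toward discharging its NAMED FACT `theoreme21`; the substitution theorem is in `KLSubstitutionProofs.lean`). Cell
`pub-zeta5`, seat ct-1 g30, 2026-08-27. Source: S. Fischler, « Formes linéaires en polyzêtas et intégrales multiples », C. R. Acad.
Sci. Paris Sér. I **335** (2002) 1–4 = arXiv:math/0202064 [Fischler2002Polyzetas], §2 Théorème 2.1 and the definitions of `δ̃_k`,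
`𝒦(p)`, `𝓛(P)` and `P = (A, B, C)` (journal version [Fischler2003RhinViola], §5).

HONEST FRAMING (cells pub-zeta5 / zeta5-irr): systematic search; no irrationality claim unless certified. Finite-product algebra
over `ℝ`; not an irrationality statement; nothing about `ζ(5)`.

## Content (theorems only; no definition; statements about SEQUENCES `ℕ → ℝ`, no integrals, no `Fin n`)
With `Π_k` a sequence satisfying `Π₀ = 1`, `Π_{k+1} = Π_k X_{k+1}` and `1 − Π_j ≠ 0` (`j ≥ 1`), and the substituted variables
`y_j = X_j` (`j` odd), `y_j = (1−Π_{j−1})X_j/(1−Π_j)` (`j` even):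
* `altSum_closed_form` — Fischler's `δ̃_k = Σ_{j≤k} (−1)^j y₁⋯y_j` TELESCOPES to the closed form
  `∏_{i≤k} (1 − Π_i)^{ε_i}`, `ε_i = +1` (`i` odd), `−1` (`i` even) (induction on `k`, carrying `y₁⋯y_k = Π_k·Q_k`);
* `parity_jacobian` — the parity products `∏_{k even ≤ n−2} δ̃_k / ∏_{k odd, 3≤k≤n−1} δ̃_k / δ̃_n` times the Jacobian weight
  `∏_{j even} (1−Π_{j−1})/(1−Π_j)²` COLLAPSE to `∏_{k=2}^n (1 − Π_k)^{−1}` (induction on `n`; the `+1` in `(1 − X₁⋯X_k)^{C_k+1}`);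
* `prod_closedForm_zpow` — the exchange `∏_{k=2}^n δ̃_k^{c_k} = ∏_{i≤n} (1 − Π_i)^{ε_i Σ_{k ≥ max(i,2)} c_k}` (the sums
  `c_k + ⋯ + c_n` of the printed `B₁`, `C_k`);
* conversions between the printed parity ranges `{2,…,n−2}` even / `{3,…,n−1}` odd and `if`-products.
-/

noncomputable section

namespace Literature.NumberTheory.Irrationality.Fischler2002

open Finset
open scoped BigOperators

namespace KL

/-! ### Small tools -/

/-- `∏_k a^{f k} = a^{Σ_k f k}` for `a ≠ 0` (integer exponents). [cite: Fischler2002Polyzetas, §2 Théorème 2.1 (C_k = … c_k + ⋯ + c_n)] -/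
theorem prod_zpow_eq_zpow_sum {a : ℝ} (ha : a ≠ 0) (f : ℕ → ℤ) (s : Finset ℕ) :
    ∏ k ∈ s, a ^ f k = a ^ (∑ k ∈ s, f k) := by
  classical
  induction s using Finset.induction_on with
  | empty => simp
  | insert k s hk ih => rw [Finset.prod_insert hk, Finset.sum_insert hk, ih, zpow_add₀ ha]

/-- The printed even range `{2,…,n−2}` as an `if`-product over `{1,…,n−2}`. [cite: Fischler2002Polyzetas, §2 p. 2 (definition of 𝒦(p))] -/
theorem prod_filter_even_eq (f : ℕ → ℝ) {n : ℕ} (hn : 2 ≤ n) :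
    ∏ k ∈ (Finset.Icc 2 (n - 2)).filter Even, f k = ∏ k ∈ Finset.Icc 1 (n - 2), if Even k then f k else 1 := by
  rw [Finset.prod_filter]
  rcases Nat.lt_or_ge n 3 with h | h
  · have e1 : (Finset.Icc 2 (n - 2) : Finset ℕ) = ∅ := Finset.Icc_eq_empty (by omega)
    have e2 : (Finset.Icc 1 (n - 2) : Finset ℕ) = ∅ := Finset.Icc_eq_empty (by omega)
    rw [e1, e2]
  · have e : (Finset.Icc 1 (n - 2) : Finset ℕ) = insert 1 (Finset.Icc 2 (n - 2)) := by
      ext k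
      simp only [Finset.mem_insert, Finset.mem_Icc]
      omega
    rw [e, Finset.prod_insert (by simp)]
    simp

/-- The printed odd range `{3,…,n−1}` as an `if`-product over `{2,…,n−1}`. [cite: Fischler2002Polyzetas, §2 p. 2 (definition of 𝒦(p))] -/
theorem prod_filter_odd_eq (f : ℕ → ℝ) {n : ℕ} (hn : 2 ≤ n) :
    ∏ k ∈ (Finset.Icc 3 (n - 1)).filter Odd, f k = ∏ k ∈ Finset.Icc 2 (n - 1), if Odd k then f k else 1 := by
  rw [Finset.prod_filter]
  rcases Nat.lt_or_ge n 3 with h | h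
  · have e1 : (Finset.Icc 3 (n - 1) : Finset ℕ) = ∅ := Finset.Icc_eq_empty (by omega)
    have e2 : (Finset.Icc 2 (n - 1) : Finset ℕ) = ∅ := Finset.Icc_eq_empty (by omega)
    rw [e1, e2]
  · have e : (Finset.Icc 2 (n - 1) : Finset ℕ) = insert 2 (Finset.Icc 3 (n - 1)) := by
      ext k
      simp only [Finset.mem_insert, Finset.mem_Icc]
      omega
    rw [e, Finset.prod_insert (by simp)]
    have h2 : ¬ Odd 2 := by decide
    simp [h2]

/-! ### The alternating sums `δ̃_k` telescope -/

/-- **Closed form of Fischler's `δ̃_k` after the substitution**: with `Π₀ = 1`, `Π_{k+1} = Π_kX_{k+1}`, `1 − Π_j ≠ 0` and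
`y_j = X_j` (`j` odd), `y_j = (1−Π_{j−1})X_j/(1−Π_j)` (`j` even), for every `k ≤ n`:
`Σ_{j=0}^{k} (−1)^j y₁⋯y_j = ∏_{i=1}^{k} (1 − Π_i)^{ε_i}`, `ε_i = −1` for even `i`, `+1` for odd `i`
(e.g. `δ̃₂ = (1−Π₁)/(1−Π₂)`, `δ̃₃ = (1−Π₁)(1−Π₃)/(1−Π₂)`). Induction on `k`, carrying `y₁⋯y_k = Π_k · ∏_{i≤k even}(1−Π_{i−1})/(1−Π_i)`.
[cite: Fischler2002Polyzetas, §2 Théorème 2.1 (changement de variables) and p. 2 (definition of δ̃_k)] -/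
theorem altSum_closed_form (X y Pi : ℕ → ℝ) (n : ℕ) (hPi0 : Pi 0 = 1) (hPis : ∀ k, Pi (k + 1) = Pi k * X (k + 1))
    (hne : ∀ j, 1 ≤ j → 1 - Pi j ≠ 0)
    (hy : ∀ j, 1 ≤ j → j ≤ n → y j = (if Even j then (1 - Pi (j - 1)) / (1 - Pi j) else 1) * X j) :
    ∀ k, k ≤ n → ∑ j ∈ Finset.range (k + 1), (-1 : ℝ) ^ j * ∏ i ∈ Finset.range j, y (i + 1) =
      ∏ i ∈ Finset.Icc 1 k, (1 - Pi i) ^ (if Even i then (-1 : ℤ) else 1) := by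
  have main : ∀ k, k ≤ n →
      (∑ j ∈ Finset.range (k + 1), (-1 : ℝ) ^ j * ∏ i ∈ Finset.range j, y (i + 1) =
          ∏ i ∈ Finset.Icc 1 k, (1 - Pi i) ^ (if Even i then (-1 : ℤ) else 1)) ∧
        (∏ i ∈ Finset.range k, y (i + 1) =
          Pi k * ∏ i ∈ Finset.Icc 1 k, (if Even i then (1 - Pi (i - 1)) / (1 - Pi i) else (1:ℝ))) ∧
        (∏ i ∈ Finset.Icc 1 k, (1 - Pi i) ^ (if Even i then (-1 : ℤ) else 1) =
          (∏ i ∈ Finset.Icc 1 k, (if Even i then (1 - Pi (i - 1)) / (1 - Pi i) else (1:ℝ))) *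
            (if Even k then 1 else (1 - Pi k))) := by
    intro k
    induction k with
    | zero =>
      intro _
      simp [hPi0]
    | succ k ih =>
      intro hk
      obtain ⟨h1, h2, h3⟩ := ih (by omega)
      have hyk : y (k + 1) = (if Even (k + 1) then (1 - Pi k) / (1 - Pi (k + 1)) else 1) * X (k + 1) := by
        rw [hy (k + 1) (by omega) hk, Nat.add_sub_cancel]
      have hnek : 1 - Pi (k + 1) ≠ 0 := hne (k + 1) (by omega)
      have eS : ∑ j ∈ Finset.range (k + 1 + 1), (-1 : ℝ) ^ j * ∏ i ∈ Finset.range j, y (i + 1) =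
          (∑ j ∈ Finset.range (k + 1), (-1 : ℝ) ^ j * ∏ i ∈ Finset.range j, y (i + 1)) +
            (-1 : ℝ) ^ (k + 1) * ((∏ i ∈ Finset.range k, y (i + 1)) * y (k + 1)) := by
        rw [Finset.sum_range_succ, Finset.prod_range_succ]
      have eR : ∏ i ∈ Finset.Icc 1 (k + 1), (1 - Pi i) ^ (if Even i then (-1 : ℤ) else 1) =
          (∏ i ∈ Finset.Icc 1 k, (1 - Pi i) ^ (if Even i then (-1 : ℤ) else 1)) *
            (1 - Pi (k + 1)) ^ (if Even (k + 1) then (-1 : ℤ) else 1) :=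
        Finset.prod_Icc_succ_top (by omega) _
      have eQ : ∏ i ∈ Finset.Icc 1 (k + 1), (if Even i then (1 - Pi (i - 1)) / (1 - Pi i) else (1:ℝ)) =
          (∏ i ∈ Finset.Icc 1 k, (if Even i then (1 - Pi (i - 1)) / (1 - Pi i) else (1:ℝ))) *
            (if Even (k + 1) then (1 - Pi k) / (1 - Pi (k + 1)) else 1) := by
        rw [Finset.prod_Icc_succ_top (by omega), Nat.add_sub_cancel]
      have eP : ∏ i ∈ Finset.range (k + 1), y (i + 1) = (∏ i ∈ Finset.range k, y (i + 1)) * y (k + 1) :=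
        Finset.prod_range_succ _ _
      rw [eS, eR, eQ, eP, h1, h2, h3, hyk]
      set Q := ∏ i ∈ Finset.Icc 1 k, (if Even i then (1 - Pi (i - 1)) / (1 - Pi i) else (1:ℝ)) with hQ
      rcases Nat.even_or_odd k with hke | hko
      · have hk1 : ¬ Even (k + 1) := Nat.not_even_iff_odd.mpr (Even.add_one hke)
        have hsgn : (-1 : ℝ) ^ (k + 1) = -1 := Odd.neg_one_pow (Even.add_one hke)
        refine ⟨?_, ?_, ?_⟩
        · simp only [if_pos hke, if_neg hk1, zpow_one, hsgn, mul_one, one_mul]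
          rw [hPis k]
          ring
        · simp only [if_neg hk1, one_mul, mul_one]
          rw [hPis k]
          ring
        · simp only [if_pos hke, if_neg hk1, zpow_one, mul_one]
      · have hk1 : Even (k + 1) := Odd.add_one hko
        have hkne : ¬ Even k := Nat.not_even_iff_odd.mpr hko
        have hsgn : (-1 : ℝ) ^ (k + 1) = 1 := Even.neg_one_pow hk1
        have hnk : 1 - Pi k ≠ 0 := hne k (by obtain ⟨r, hr⟩ := hko; omega)
        have hnek2 : 1 - Pi k * X (k + 1) ≠ 0 := by rwa [hPis k] at hnek
        refine ⟨?_, ?_, ?_⟩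
        · simp only [if_neg hkne, if_pos hk1, zpow_neg_one, hsgn, one_mul]
          rw [hPis k]
          field_simp
          ring
        · simp only [if_pos hk1]
          rw [hPis k]
          ring
        · simp only [if_neg hkne, if_pos hk1, zpow_neg_one, mul_one]
          field_simp
  intro k hk
  exact (main k hk).1

/-! ### The parity products and the Jacobian collapse to `∏_{k ≥ 2} (1 − Π_k)^{−1}` -/

/-- **The parity products of `𝒦(p)` times the Jacobian weight** (in the closed form of `altSum_closed_form`, written for any
sequence `R` with `R₀ = 1`, `R_{k+1} = R_k (1 − Π_{k+1})^{ε_{k+1}}`, `R_k ≠ 0`): for every `m` (`n = m + 2`),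
`[∏_{k ≤ m, even} R_k] / [∏_{2 ≤ k ≤ m+1, odd} R_k] / R_{m+2} · ∏_{j ≤ m+2 even} (1−Π_{j−1})/(1−Π_j)² = ∏_{k=2}^{m+2} (1 − Π_k)^{−1}`
— the extra factor `∏_{k∈{2,…,n−2} even} δ̃_k / ∏_{k∈{3,…,n−1} odd} δ̃_k · 1/δ̃_n` of `𝒦(p)` and `|∂x/∂X|` together produce exactly
the `+1` of Fischler's exponents `C_k + 1`. Induction on `m` (two parities). [cite: Fischler2002Polyzetas, §2 Théorème 2.1 and p. 2 (definition of 𝒦(p))] -/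
theorem parity_jacobian (Pi R : ℕ → ℝ) (hne : ∀ j, 1 ≤ j → 1 - Pi j ≠ 0) (hR0 : R 0 = 1)
    (hR : ∀ k, R (k + 1) = R k * (1 - Pi (k + 1)) ^ (if Even (k + 1) then (-1 : ℤ) else 1)) (hRne : ∀ k, R k ≠ 0) :
    ∀ m : ℕ,
      (∏ k ∈ Finset.Icc 1 m, if Even k then R k else 1) / (∏ k ∈ Finset.Icc 2 (m + 1), if Odd k then R k else 1) /
            R (m + 2) *
          (∏ j ∈ Finset.Icc 1 (m + 2), if Even j then (1 - Pi (j - 1)) / (1 - Pi j) ^ 2 else (1:ℝ)) =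
        ∏ k ∈ Finset.Icc 2 (m + 2), (1 - Pi k) ^ (-1 : ℤ) := by
  intro m
  induction m with
  | zero =>
    have hR1 : R 1 = 1 - Pi 1 := by
      rw [show (1:ℕ) = 0 + 1 from rfl, hR 0, hR0]
      simp
    have hR2 : R 2 = (1 - Pi 1) * (1 - Pi 2) ^ (-1 : ℤ) := by
      rw [show (2:ℕ) = 1 + 1 from rfl, hR 1, hR1]
      simp
    have h12 : (Finset.Icc 1 2 : Finset ℕ) = {1, 2} := by decide
    have h1 := hne 1 le_rfl
    have h2 := hne 2 (by norm_num)
    simp only [Finset.Icc_self, Finset.prod_singleton, show (Finset.Icc 1 0 : Finset ℕ) = ∅ by decide,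
      show (Finset.Icc 2 1 : Finset ℕ) = ∅ by decide, Finset.prod_empty, h12, Finset.prod_insert (show 1 ∉ ({2} : Finset ℕ) by decide),
      show ¬ Even 1 by decide, show Even 2 by decide, if_true, if_false, hR2, zpow_neg_one, show (2:ℕ) - 1 = 1 from rfl]
    field_simp
  | succ m ih =>
    have hm2 := hne (m + 2) (by omega)
    have hm3 := hne (m + 3) (by omega)
    have hRm1 := hRne (m + 1)
    have hRm2 := hRne (m + 2)
    -- the four recursions
    have eN : (∏ k ∈ Finset.Icc 1 (m + 1), if Even k then R k else (1:ℝ)) =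
        (∏ k ∈ Finset.Icc 1 m, if Even k then R k else (1:ℝ)) * (if Even (m + 1) then R (m + 1) else 1) :=
      Finset.prod_Icc_succ_top (by omega) _
    have eD : (∏ k ∈ Finset.Icc 2 (m + 1 + 1), if Odd k then R k else (1:ℝ)) =
        (∏ k ∈ Finset.Icc 2 (m + 1), if Odd k then R k else (1:ℝ)) * (if Odd (m + 2) then R (m + 2) else 1) :=
      Finset.prod_Icc_succ_top (by omega) _
    have eW : (∏ j ∈ Finset.Icc 1 (m + 1 + 2), if Even j then (1 - Pi (j - 1)) / (1 - Pi j) ^ 2 else (1:ℝ)) =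
        (∏ j ∈ Finset.Icc 1 (m + 2), if Even j then (1 - Pi (j - 1)) / (1 - Pi j) ^ 2 else (1:ℝ)) *
          (if Even (m + 3) then (1 - Pi (m + 2)) / (1 - Pi (m + 3)) ^ 2 else 1) := by
      rw [show m + 1 + 2 = m + 2 + 1 by ring, Finset.prod_Icc_succ_top (by omega), show m + 2 + 1 - 1 = m + 2 from rfl]
    have eT : ∏ k ∈ Finset.Icc 2 (m + 1 + 2), (1 - Pi k) ^ (-1 : ℤ) =
        (∏ k ∈ Finset.Icc 2 (m + 2), (1 - Pi k) ^ (-1 : ℤ)) * (1 - Pi (m + 3)) ^ (-1 : ℤ) := by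
      rw [show m + 1 + 2 = m + 2 + 1 by ring, Finset.prod_Icc_succ_top (by omega)]
    have eR : R (m + 1 + 2) = R (m + 2) * (1 - Pi (m + 3)) ^ (if Even (m + 3) then (-1 : ℤ) else 1) := by
      rw [show m + 1 + 2 = m + 2 + 1 by ring, hR (m + 2)]
    rw [eN, eD, eW, eT, eR, ← ih]
    set N := ∏ k ∈ Finset.Icc 1 m, if Even k then R k else (1:ℝ) with hN
    set D := ∏ k ∈ Finset.Icc 2 (m + 1), if Odd k then R k else (1:ℝ) with hD
    set W := ∏ j ∈ Finset.Icc 1 (m + 2), if Even j then (1 - Pi (j - 1)) / (1 - Pi j) ^ 2 else (1:ℝ) with hW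
    have hDne : D ≠ 0 := Finset.prod_ne_zero_iff.mpr fun k _ => by
      by_cases h : Odd k
      · rw [if_pos h]; exact hRne k
      · rw [if_neg h]; exact one_ne_zero
    rcases Nat.even_or_odd m with hme | hmo
    · -- `m` even: `m+1` odd, `m+2` even, `m+3` odd
      have h1 : ¬ Even (m + 1) := Nat.not_even_iff_odd.mpr (Even.add_one hme)
      have h2 : ¬ Odd (m + 2) := Nat.not_odd_iff_even.mpr (by obtain ⟨r, hr⟩ := hme; exact ⟨r + 1, by omega⟩)
      have h3 : ¬ Even (m + 3) := Nat.not_even_iff_odd.mpr (by obtain ⟨r, hr⟩ := hme; exact ⟨r + 1, by omega⟩)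
      simp only [if_neg h1, if_neg h2, if_neg h3, mul_one, zpow_one, zpow_neg_one]
      field_simp
    · -- `m` odd: `m+1` even, `m+2` odd, `m+3` even
      have h1 : Even (m + 1) := Odd.add_one hmo
      have h2 : Odd (m + 2) := by obtain ⟨r, hr⟩ := hmo; exact ⟨r + 1, by omega⟩
      have h3 : Even (m + 3) := by obtain ⟨r, hr⟩ := hmo; exact ⟨r + 2, by omega⟩
      have hR2 : R (m + 2) = R (m + 1) * (1 - Pi (m + 2)) := by
        rw [hR (m + 1), if_neg (Nat.not_even_iff_odd.mpr h2), zpow_one]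
      simp only [if_pos h1, if_pos h2, if_pos h3, zpow_neg_one, hR2]
      field_simp

/-! ### The exchange `∏_k δ̃_k^{c_k} = ∏_i (1 − Π_i)^{ε_i Σ_{k ≥ max(i,2)} c_k}` -/

/-- **Exchange of the double product**: `∏_{k=2}^n (∏_{i≤k} (1−Π_i)^{ε_i})^{c_k} = ∏_{i=1}^n (1−Π_i)^{ε_i·(c_{max(i,2)} + ⋯ + c_n)}`
(the sums `c_k + ⋯ + c_n` in Fischler's `B₁` and `C_k`). [cite: Fischler2002Polyzetas, §2 Théorème 2.1 (formules pour B₁, C_k)] -/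
theorem prod_closedForm_zpow (Pi : ℕ → ℝ) (c : ℕ → ℤ) (n : ℕ) (hne : ∀ j, 1 ≤ j → 1 - Pi j ≠ 0) :
    ∏ k ∈ Finset.Icc 2 n, (∏ i ∈ Finset.Icc 1 k, (1 - Pi i) ^ (if Even i then (-1 : ℤ) else 1)) ^ c k =
      ∏ i ∈ Finset.Icc 1 n, (1 - Pi i) ^ ((if Even i then (-1 : ℤ) else 1) * ∑ k ∈ Finset.Icc (max i 2) n, c k) := by
  have step1 : ∀ k ∈ Finset.Icc 2 n, (∏ i ∈ Finset.Icc 1 k, (1 - Pi i) ^ (if Even i then (-1 : ℤ) else 1)) ^ c k =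
      ∏ i ∈ Finset.Icc 1 k, (1 - Pi i) ^ ((if Even i then (-1 : ℤ) else 1) * c k) := by
    intro k _
    rw [← Finset.prod_zpow]
    exact Finset.prod_congr rfl fun i _ => by rw [zpow_mul]
  rw [Finset.prod_congr rfl step1,
    Finset.prod_comm' (s := Finset.Icc 2 n) (t := fun k => Finset.Icc 1 k) (t' := Finset.Icc 1 n)
      (s' := fun i => Finset.Icc (max i 2) n)
      (fun k i => by simp only [Finset.mem_Icc]; omega)]
  refine Finset.prod_congr rfl fun i hi => ?_
  rw [prod_zpow_eq_zpow_sum (hne i (Finset.mem_Icc.1 hi).1), Finset.mul_sum]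

/-! ### The numerator `∏ x_k^{a_k}(1−x_k)^{b_k}` after the substitution -/

/-- Index shift `j = i + 1` for the factors `(1 − Π_{j−1})^{e_j}` (`e₁ = 0`, `Π₀ = 1`).
[cite: Fischler2002Polyzetas, §2 Théorème 2.1 (C_k for odd k: the term a_{n−k})] -/
theorem prod_shift_pred (Pi : ℕ → ℝ) (e : ℕ → ℤ) {n : ℕ} (hn : 1 ≤ n) (he1 : e 1 = 0) :
    ∏ j ∈ Finset.Icc 1 n, (1 - Pi (j - 1)) ^ e j =
      ∏ i ∈ Finset.Icc 1 n, (1 - Pi i) ^ (if i + 1 ≤ n then e (i + 1) else 0) := by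
  obtain ⟨m, rfl⟩ : ∃ m, n = m + 1 := ⟨n - 1, by omega⟩
  have h1 : ∏ j ∈ Finset.Icc 1 (m + 1), (1 - Pi (j - 1)) ^ e j = ∏ i ∈ Finset.Icc 0 m, (1 - Pi i) ^ e (i + 1) := by
    refine Finset.prod_nbij' (fun j => j - 1) (fun i => i + 1) (fun j hj => ?_) (fun i hi => ?_) (fun j hj => ?_)
      (fun i hi => ?_) (fun j hj => ?_)
    · simp only [Finset.mem_Icc] at hj ⊢; omega
    · simp only [Finset.mem_Icc] at hi ⊢; omega
    · simp only [Finset.mem_Icc] at hj; omega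
    · omega
    · rw [Nat.sub_add_cancel (Finset.mem_Icc.1 hj).1]
  have h2 : (Finset.Icc 0 m : Finset ℕ) = insert 0 (Finset.Icc 1 m) := by
    ext k
    simp only [Finset.mem_insert, Finset.mem_Icc]
    omega
  rw [h1, h2, Finset.prod_insert (by simp), zero_add, he1, zpow_zero, one_mul,
    Finset.prod_Icc_succ_top (by omega : 1 ≤ m + 1), if_neg (by omega : ¬ (m + 1 + 1 ≤ m + 1)), zpow_zero, mul_one]
  exact Finset.prod_congr rfl fun i hi => by rw [if_pos (by have := (Finset.mem_Icc.1 hi).2; omega)]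

/-- **The numerator after the substitution**: with `y_j = X_j` (`j` odd) and `y_j = (1−Π_{j−1})X_j/(1−Π_j)`,
`1 − y_j = (1−X_j)/(1−Π_j)` (`j` even),
`∏_j y_j^{α_j}(1−y_j)^{β_j} = ∏_j X_j^{α_j}(1−X_j)^{β_j} · ∏_i (1−Π_i)^{[i+1 even, ≤ n]α_{i+1} − [i even](α_i+β_i)}`
(the powers of `1 − X₁⋯X_k` contributed by the numerator to Fischler's `B₁`, `C_k`).
[cite: Fischler2002Polyzetas, §2 Théorème 2.1 (formules pour A_k, B_k, C_k)] -/
theorem numerator_subst (X y Pi : ℕ → ℝ) (α β : ℕ → ℤ) {n : ℕ} (hn : 1 ≤ n)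
    (hPis : ∀ k, Pi (k + 1) = Pi k * X (k + 1)) (hne : ∀ j, 1 ≤ j → 1 - Pi j ≠ 0)
    (hy : ∀ j, 1 ≤ j → j ≤ n → y j = (if Even j then (1 - Pi (j - 1)) / (1 - Pi j) else 1) * X j) :
    ∏ j ∈ Finset.Icc 1 n, y j ^ α j * (1 - y j) ^ β j =
      (∏ j ∈ Finset.Icc 1 n, X j ^ α j * (1 - X j) ^ β j) *
        ∏ i ∈ Finset.Icc 1 n, (1 - Pi i) ^
          ((if Even (i + 1) ∧ i + 1 ≤ n then α (i + 1) else 0) - (if Even i then α i + β i else 0)) := by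
  have hpt : ∀ j ∈ Finset.Icc 1 n, y j ^ α j * (1 - y j) ^ β j =
      (X j ^ α j * (1 - X j) ^ β j) * ((1 - Pi (j - 1)) ^ (if Even j then α j else 0) *
        (1 - Pi j) ^ (-(if Even j then α j + β j else 0))) := by
    intro j hj
    have hj' := Finset.mem_Icc.1 hj
    have hnj := hne j hj'.1
    rw [hy j hj'.1 hj'.2]
    by_cases hje : Even j
    · obtain ⟨i, rfl⟩ : ∃ i, j = i + 1 := ⟨j - 1, by omega⟩
      rw [Nat.add_sub_cancel]
      simp only [if_pos hje]
      have h1y : 1 - (1 - Pi i) / (1 - Pi (i + 1)) * X (i + 1) = (1 - X (i + 1)) * (1 - Pi (i + 1))⁻¹ := by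
        rw [eq_mul_inv_iff_mul_eq₀ hnj, sub_mul, one_mul, mul_right_comm, div_mul_cancel₀ _ hnj, hPis i]
        ring
      rw [h1y, mul_zpow, mul_zpow, div_zpow, inv_zpow', neg_add, zpow_add₀ hnj]
      have hA : (1 - Pi (i + 1)) ^ α (i + 1) ≠ 0 := zpow_ne_zero _ hnj
      rw [zpow_neg, zpow_neg]
      field_simp
    · simp only [if_neg hje, one_mul, zpow_zero, neg_zero, mul_one]
  rw [Finset.prod_congr rfl hpt, Finset.prod_mul_distrib]
  congr 1
  rw [Finset.prod_mul_distrib, prod_shift_pred Pi (fun j => if Even j then α j else 0) hn (by simp),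
    ← Finset.prod_mul_distrib]
  refine Finset.prod_congr rfl fun i hi => ?_
  rw [← zpow_add₀ (hne i (Finset.mem_Icc.1 hi).1)]
  congr 1
  by_cases h1 : i + 1 ≤ n <;> by_cases h2 : Even (i + 1) <;> by_cases h3 : Even i <;> simp [h1, h2, h3]
  all_goals ring

end KL

end Literature.NumberTheory.Irrationality.Fischler2002

end
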